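import Summits.ResolutionOfSingularities.ResolutionOfSingularities.Theorems.WildQuotientsSummitReductionStubPairOrbitNormalFormBlowupCentreFormalIdeal
import Literature.AlgebraicGeometry.Resolution.AlterationsNormalFormBlowupFormal
import HarnessLib

/-!
# `WildQuotients.SummitReduction` (stmt-ResolutionOfSingularities-16324), line `FramePerfect`, stub S
# (`stub_pair_orbitNormalFormBlowup`): sub-goal (O1) — the singular locus of the blow-up over the
# orbit centre — from the chart computation on the coefficient-free model

Route `ResolutionOfSingularities/WildQuotients`, crux `SummitReduction`; helper file of the line
skeleton (v8), stub S = the orbit version of de Jong 1996, Claim 4.27 for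
`DeJong1997.QuasiSplitNormalFormPair`. Sub-goal (O1) of `quasiSplitNormalFormPair_blowup_of_overCentre`
(`…OrbitNormalFormBlowupReduction.lean`) says: a point `x'` of the blow-up `X'` over the orbit
centre `C` is singular iff it lies on the strict transform of a component `E' ⊄ C` of `Sing X`
(de Jong 1996, 4.27 [C1] over the centre: "Then `Sing(X')` is the union of the `Ẽ'` so
obtained"). This file reduces (O1) to the ONE statement whose printed proof is the chart
computation of 4.27, on the COEFFICIENT-FREE model (tree analogue over a field:
`DeJong1996NodalBlowupSingularLocus`): for a blow-up `B → Spec A⟦u, v⟧/(uv - ∏_{i<s} tᵢ)` in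
`𝔭_{a₀b₀} = (t_{a₀}, t_{b₀}) + (u, v)`, every non-regular point of `B` over `V(𝔭_{a₀b₀})` lies on
the strict transform of some `V(𝔭_{ab})`, `a < b < s`.

* `singularLocus_subset_biUnion_strictTransformSet_of_closedPoints` — closed points suffice
  (`X'` is Jacobson, the union of the strict transforms is closed);
* `singularOverCentre_of_closedPoints` — (O1) from its instance at the CLOSED singular points
  over `C` (the direction "on a strict transform ⇒ singular" is
  `strictTransformSet_subset_setOf_not_isRegularLocalRing`, `Sing X'` being closed over the
  perfect field);
* `stub_pair_orbitNormalFormBlowup_singularOverCentre_of_model` — **(O1) from the model-level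
  chart statement**: at a closed singular `x'` over `x = π x' ∈ C`, base change the blow-up along
  the flat `Spec A⟦u,v⟧/(uv - ∏ tᵢ) ≅ Spec 𝒪̂_{X,x} → X` (`IsBlowup.pullback_snd_of_flat`); by
  the dictionary `quasiSplitNormalFormPair_centreFormalIdeal` (with
  `quasiSplitNormalFormPair_centreFormalIdeal_orbit` for the centre) the centre becomes
  `𝔭_{a₀b₀}` and the strict transform of `V(𝔭_{ab})` projects into the strict transform of the
  component `E''` with `Î_{E''} = 𝔭_{ab}` — the proof of
  `DeJong1996NormalFormPairBlowupSingularOverCentre.of_centreFormalIdeal_of_nodalBlowup` verbatim.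

## Sources

* A. J. de Jong, *Smoothness, semi-stability and alterations*, Publ. Math. IHÉS 83 (1996), 4.27,
  pp. 75–76. [DeJong1996]
* A. J. de Jong, *Families of curves and alterations*, Ann. Inst. Fourier 47 (1997), proof of
  Prop. 5.11, p. 619. [DeJong1997]
-/

set_option linter.dupNamespace false -- the tree's summit namespace repeats `ResolutionOfSingularities`

noncomputable section

open CategoryTheory CategoryTheory.Limits AlgebraicGeometry TopologicalSpace Topology
open Literature.AlgebraicGeometry.Resolution
open Literature.AlgebraicGeometry
open IsLocalRing Scheme.IdealSheafData

namespace Summit.ResolutionOfSingularities.ResolutionOfSingularities.Theorems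

/-! ## Closed points suffice -/

/-- **Closed points suffice for (O1).** On a Jacobson `X'` with closed singular locus, if `π` is
an isomorphism over `X ∖ C` (`C` closed, the components of the closed `Sing X` finitely many) and
every CLOSED singular point over `C` lies on the strict transform of a component `E' ⊄ C` of
`Sing X`, then every singular point of `X'` does (off `C`:
`exists_mem_strictTransformSet_of_notMem_centre`; the union of the strict transforms is closed
and contains the closed points of the closed `Sing X'`). [folklore] -/
theorem singularLocus_subset_biUnion_strictTransformSet_of_closedPoints {X' X : Scheme.{0}}
    [JacobsonSpace X'] (π : X' ⟶ X) {C : Set X} (hC : IsClosed C)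
    [IsIso (π ∣_ ⟨Cᶜ, hC.isOpen_compl⟩)]
    (hS : IsClosed ({x : X | ¬ IsRegularLocalRing (X.presheaf.stalk x)} : Set X))
    (hfin : (componentsIn ({x : X | ¬ IsRegularLocalRing (X.presheaf.stalk x)} : Set X)).Finite)
    (hS'c : IsClosed ({x : X' | ¬ IsRegularLocalRing (X'.presheaf.stalk x)} : Set X'))
    (H : ∀ x' : X', IsClosed ({x'} : Set X') → π.base x' ∈ C →
      ¬ IsRegularLocalRing (X'.presheaf.stalk x') →
        ∃ E' ∈ componentsIn ({x : X | ¬ IsRegularLocalRing (X.presheaf.stalk x)} : Set X),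
          ¬ E' ⊆ C ∧ x' ∈ strictTransformSet π C E') :
    ({x : X' | ¬ IsRegularLocalRing (X'.presheaf.stalk x)} : Set X') ⊆
      ⋃ E' ∈ {E' ∈ componentsIn ({x : X | ¬ IsRegularLocalRing (X.presheaf.stalk x)} : Set X) |
        ¬ E' ⊆ C}, strictTransformSet π C E' := by
  -- adapted from `setOf_not_isRegularLocalRing_subset_biUnion_of_closedPoints` (AlterationsNormalFormBlowupCentre.lean)
  have hTc : IsClosed (⋃ E' ∈ {E' ∈ componentsIn
      ({x : X | ¬ IsRegularLocalRing (X.presheaf.stalk x)} : Set X) | ¬ E' ⊆ C},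
      strictTransformSet π C E') :=
    (hfin.subset (Set.sep_subset _ _)).isClosed_biUnion fun E' _ => strictTransformSet.isClosed π C E'
  rw [← hS'c.closure_eq, ← JacobsonSpace.closure_inter_closedPoints_eq_closure hS'c.isLocallyClosed]
  refine closure_minimal ?_ hTc
  rintro x' ⟨hx's, hx'c⟩
  rw [mem_closedPoints_iff] at hx'c
  simp only [Set.mem_iUnion, Set.mem_setOf_eq, exists_prop]
  by_cases hx : π.base x' ∈ C
  · obtain ⟨E', hE', hne, h⟩ := H x' hx'c hx hx's
    exact ⟨E', ⟨hE', hne⟩, h⟩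
  · obtain ⟨E', hE', -, h⟩ := exists_mem_strictTransformSet_of_notMem_centre π hC rfl hx hx's
    refine ⟨E', ⟨hE', fun hsub => hx (hsub ?_)⟩, h⟩
    exact strictTransformSet.subset_preimage π C (componentsIn.isClosed hS hE') h

/-- The strict transform of a subset of the centre is empty. [folklore] -/
theorem strictTransformSet_eq_empty_of_subset {X' X : Scheme.{0}} (π : X' ⟶ X) {C T : Set X}
    (h : T ⊆ C) : strictTransformSet π C T = ∅ := by
  rw [strictTransformSet, Set.sdiff_eq_empty.mpr h, Set.preimage_empty, closure_empty]

/-- **(O1) from its closed points**: for a blow-up `π` of a `QuasiSplitNormalFormPair` over a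
perfect field in (the reduced ideal of) a closed `C ⊆ Sing X`, if every closed singular point of
`X'` over `C` lies on the strict transform of a component `E' ⊄ C` of `Sing X`, then a point over
`C` is singular iff it lies on such a strict transform. [cite: DeJong1996, 4.27, pp. 75–76] -/
theorem singularOverCentre_of_closedPoints {k : Type} [Field k] [PerfectField k] {X X' : Scheme.{0}}
    {p : X ⟶ Spec (.of k)} {Z : Set X} {G : Type} [Group G] {ρ : G →* Aut X} {d : ℕ}
    (hP : DeJong1997.QuasiSplitNormalFormPair p Z ρ d) {C : Set X} (hC : IsClosed C)
    {π : X' ⟶ X} (hπ : IsBlowup π (vanishingIdeal ⟨C, hC⟩))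
    (H : ∀ x' : X', IsClosed ({x'} : Set X') → π.base x' ∈ C →
      ¬ IsRegularLocalRing (X'.presheaf.stalk x') →
        ∃ E' ∈ componentsIn ({x : X | ¬ IsRegularLocalRing (X.presheaf.stalk x)} : Set X),
          ¬ E' ⊆ C ∧ x' ∈ strictTransformSet π C E')
    (x' : X') (_hx : π.base x' ∈ C) :
    ¬ IsRegularLocalRing (X'.presheaf.stalk x') ↔
      ∃ E' ∈ componentsIn ({x : X | ¬ IsRegularLocalRing (X.presheaf.stalk x)} : Set X),
        ¬ E' ⊆ C ∧ x' ∈ strictTransformSet π C E' := by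
  have hS := hP.isClosed_setOf_not_isRegularLocalRing
  haveI := hP.isIntegral
  haveI := hP.locallyOfFiniteType
  haveI : IsNoetherian X := hP.isNoetherian
  haveI : IsProper π := hπ.isProper
  haveI : JacobsonSpace X' := LocallyOfFiniteType.jacobsonSpace (π ≫ p)
  have hS'c : IsClosed ({x : X' | ¬ IsRegularLocalRing (X'.presheaf.stalk x)} : Set X') :=
    DeJong1996.NormalFormPair.isClosed_setOf_not_isRegularLocalRing_of_locallyOfFiniteType (π ≫ p)
  haveI : IsIso (π ∣_ ⟨Cᶜ, hC.isOpen_compl⟩) :=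
    DeJong1996.NormalFormPair.isIso_morphismRestrict_compl_of_isBlowup ⟨C, hC⟩ hπ
  have hfin : (componentsIn ({x : X | ¬ IsRegularLocalRing (X.presheaf.stalk x)} : Set X)).Finite :=
    componentsIn.finite _
  constructor
  · intro hx's
    have h := singularLocus_subset_biUnion_strictTransformSet_of_closedPoints π hC hS hfin hS'c H hx's
    simp only [Set.mem_iUnion, Set.mem_setOf_eq, exists_prop] at h
    obtain ⟨E', ⟨hE', hne⟩, h⟩ := h
    exact ⟨E', hE', hne, h⟩
  · rintro ⟨E', hE', -, h⟩
    exact strictTransformSet_subset_setOf_not_isRegularLocalRing π hC rfl hS'c hE' h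

/-! ## (O1) at the closed points, from the chart computation on the model -/

/-- **(O1) at a closed singular point over the centre, from the model-level chart statement**
(hypothesis `hNB`: for a blow-up `B → Spec A⟦u, v⟧/(uv - ∏_{i<s} tᵢ)` in `𝔭_{a₀b₀}`, every
non-regular point over `V(𝔭_{a₀b₀})` lies on the strict transform of some `V(𝔭_{ab})`,
`a < b < s` — de Jong 1996, 4.27, chart "`t₁ ≠ 0`": "The irreducible component
`u' = v' = t₂' = t₃ = 0` of the singular locus maps onto `u = v = t₂ = t₃ = 0`, the component
`u' = v' = t₃ = t₄ = 0` is the strict transform of the component `u = v = t₃ = t₄ = 0`"): a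
closed singular point `x'` of `X'` over `x ∈ C` lies on the strict transform of a component
`E'' ⊄ C` of `Sing X`. Base change `π` along the flat `Spec A⟦u,v⟧/(uv - ∏ tᵢ) → X` through `x`
(`IsBlowup.pullback_snd_of_flat`): the centre becomes `Î_C = Î_T = 𝔭_{a₀b₀}` (`T` the translate
of `E` through `x`, `quasiSplitNormalFormPair_centreFormalIdeal_orbit` and the dictionary (1) of
`quasiSplitNormalFormPair_centreFormalIdeal`), `x'` lifts to a non-regular point `y` (flat local
descent of regularity), `hNB` puts `y` on the strict transform of some `V(𝔭_{ab})`, which projects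
into the strict transform of the component `E''` with `Î_{E''} = 𝔭_{ab}` (dictionary (2)); and
`E'' ⊄ C` since the strict transform of a subset of the centre is empty.
[cite: DeJong1996, 4.27, pp. 75–76] [cite: DeJong1997, proof of Prop. 5.11, p. 619] -/
theorem singularOverCentre_closedPoint_of_model {k : Type} [Field k] {X X' : Scheme.{0}}
    {p : X ⟶ Spec (.of k)} {Z : Set X} {G : Type} [Group G] [Finite G] {ρ : G →* Aut X} {d : ℕ}
    (hP : DeJong1997.QuasiSplitNormalFormPair p Z ρ d)
    {E : Set ↥({x : X | ¬ IsRegularLocalRing (X.presheaf.stalk x)} : Set X)}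
    (hE : E ∈ irreducibleComponents ↥({x : X | ¬ IsRegularLocalRing (X.presheaf.stalk x)} : Set X))
    {π : X' ⟶ X}
    (hπ : IsBlowup π (vanishingIdeal
      ⟨closure (⋃ g : G, (ρ g).hom.base '' (Subtype.val '' E)), isClosed_closure⟩))
    (hNB : ∀ (A : Type) [CommRing A] [IsRegularLocalRing A] (m : ℕ) (t : Fin m → A),
      Ideal.span (Set.range t) = maximalIdeal A → ringKrullDim A = m →
      ∀ (s : ℕ) (a₀ b₀ : Fin m), a₀ < b₀ → b₀.val < s →
      ∀ (B : Scheme.{0}) (ρ₁ : B ⟶ Spec (.of (DeJong1996.NodeDeformationRing A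
          (∏ i ∈ Finset.univ.filter (fun i : Fin m => i.val < s), t i)))),
        IsBlowup ρ₁ (ofIdealTop
          (((Ideal.span {t a₀, t b₀}).map (DeJong1996.NodeDeformationRing.ofBase A _) ⊔
              Ideal.span {Ideal.Quotient.mk _ (MvPowerSeries.X 0), Ideal.Quotient.mk _ (MvPowerSeries.X 1)}).map (Scheme.ΓSpecIso (.of (DeJong1996.NodeDeformationRing A
            (∏ i ∈ Finset.univ.filter (fun i : Fin m => i.val < s), t i)))).inv.hom)) →
        ∀ y : B, ((Ideal.span {t a₀, t b₀}).map (DeJong1996.NodeDeformationRing.ofBase A _) ⊔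
              Ideal.span {Ideal.Quotient.mk _ (MvPowerSeries.X 0), Ideal.Quotient.mk _ (MvPowerSeries.X 1)}) ≤ (ρ₁.base y).asIdeal → ¬ IsRegularLocalRing (B.presheaf.stalk y) →
          ∃ a b : Fin m, a < b ∧ b.val < s ∧
            y ∈ closure (ρ₁.base ⁻¹' {w | ((Ideal.span {t a, t b}).map (DeJong1996.NodeDeformationRing.ofBase A _) ⊔
              Ideal.span {Ideal.Quotient.mk _ (MvPowerSeries.X 0), Ideal.Quotient.mk _ (MvPowerSeries.X 1)}) ≤ w.asIdeal ∧ ¬ ((Ideal.span {t a₀, t b₀}).map (DeJong1996.NodeDeformationRing.ofBase A _) ⊔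
              Ideal.span {Ideal.Quotient.mk _ (MvPowerSeries.X 0), Ideal.Quotient.mk _ (MvPowerSeries.X 1)}) ≤ w.asIdeal}))
    {x' : X'} (hx'c : IsClosed ({x'} : Set X'))
    (hx : π.base x' ∈ closure (⋃ g : G, (ρ g).hom.base '' (Subtype.val '' E)))
    (hx's : ¬ IsRegularLocalRing (X'.presheaf.stalk x')) :
    ∃ E'' ∈ componentsIn ({x : X | ¬ IsRegularLocalRing (X.presheaf.stalk x)} : Set X),
      ¬ E'' ⊆ closure (⋃ g : G, (ρ g).hom.base '' (Subtype.val '' E)) ∧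
        x' ∈ strictTransformSet π (closure (⋃ g : G, (ρ g).hom.base '' (Subtype.val '' E))) E'' := by
  -- adapted from `DeJong1996NormalFormPairBlowupSingularOverCentre.of_centreFormalIdeal_of_nodalBlowup`
  have hS := hP.isClosed_setOf_not_isRegularLocalRing
  haveI := hP.isIntegral
  haveI := hP.locallyOfFiniteType
  haveI : IsNoetherian X := hP.isNoetherian
  haveI : IsProper π := hπ.isProper
  haveI : IsLocallyNoetherian X' := LocallyOfFiniteType.isLocallyNoetherian (π ≫ p)
  -- the closed point `x = π x'`, singular
  have hxc : IsClosed ({π.base x'} : Set X) := by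
    have := π.isClosedMap _ hx'c
    rwa [Set.image_singleton] at this
  have hxS : ¬ IsRegularLocalRing (X.presheaf.stalk (π.base x')) := hP.closure_orbit_subset E hx
  -- the model at `x` and the dictionary
  obtain ⟨A, _, _, t, s, r, hspan, hdim, -, -, -, e, -, hdict, hdict2⟩ :=
    quasiSplitNormalFormPair_centreFormalIdeal hP hxc hxS
  obtain ⟨T, hT, hxT, -, -, hTcompl⟩ := quasiSplitNormalFormPair_centreFormalIdeal_orbit hP hE hx
  obtain ⟨a₀, b₀, hab₀, hb₀s, hcentreT⟩ := hdict T hT hxT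
  -- the flat local ring map `c : 𝒪_{X,x} → 𝒪̂_{X,x} ≅ model`
  let O : CommRingCat.{0} := X.presheaf.stalk (π.base x')
  let Ô := AdicCompletion (maximalIdeal O) O
  let M := DeJong1996.NodeDeformationRing A
    (∏ i ∈ Finset.univ.filter (fun i : Fin (d - 1) => i.val < s), t i)
  let c : O ⟶ CommRingCat.of M := CommRingCat.ofHom ((e : Ô →+* M).comp (algebraMap O Ô))
  have hc : c.hom = (e : Ô →+* M).comp (algebraMap O Ô) := rfl
  have hcflat : c.hom.Flat := by
    rw [hc]
    exact RingHom.Flat.comp (RingHom.flat_algebraMap_iff.mpr (AdicCompletion.flat_of_isNoetherian _))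
      (RingHom.Flat.of_bijective e.bijective)
  haveI : IsLocalHom c.hom := by
    rw [hc]
    infer_instance
  haveI : Nontrivial M := e.injective.nontrivial
  haveI : IsLocalRing M := IsLocalRing.of_surjective' (e : Ô →+* M) e.surjective
  -- completed stalk ideals through `c`
  have hmapc : ∀ (T : Closeds X) (U : X.affineOpens) (hU : π.base x' ∈ (U : X.Opens)),
      (stalkIdeal (vanishingIdeal T) (π.base x')).map c.hom =
        (completedStalkIdeal (vanishingIdeal T) (π.base x') U hU).map e.toRingHom := by
    intro T U hU
    rw [completedStalkIdeal_eq_map_stalkIdeal, Ideal.map_map, hc]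
    rfl
  obtain ⟨U, hU, hxU, -⟩ :=
    exists_isAffineOpen_mem_and_subset (X := X) (x := π.base x') (U := ⊤) (Opens.mem_top _)
  have hcentre' : (stalkIdeal (vanishingIdeal ⟨closure (⋃ g : G, (ρ g).hom.base '' (Subtype.val '' E)),
      isClosed_closure⟩) (π.base x')).map c.hom = ((Ideal.span {t a₀, t b₀}).map (DeJong1996.NodeDeformationRing.ofBase A _) ⊔
              Ideal.span {Ideal.Quotient.mk _ (MvPowerSeries.X 0), Ideal.Quotient.mk _ (MvPowerSeries.X 1)}) := by
    rw [hmapc _ ⟨U, hU⟩ hxU, hTcompl ⟨U, hU⟩ hxU, hcentreT ⟨U, hU⟩ hxU]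
  -- the flat morphism `ι : Spec M → X` and the base-changed blow-up
  let ι : Spec (.of M) ⟶ X := Spec.map c ≫ X.fromSpecStalk (π.base x')
  haveI : Flat (Spec.map c) := Flat.SpecMap_iff.mpr hcflat
  haveI : Flat (X.fromSpecStalk (π.base x')) := flat_fromSpecStalk X (π.base x')
  haveI : Flat ι := inferInstance
  have hB : IsBlowup (pullback.snd π ι) (ofIdealTop (((Ideal.span {t a₀, t b₀}).map (DeJong1996.NodeDeformationRing.ofBase A _) ⊔
              Ideal.span {Ideal.Quotient.mk _ (MvPowerSeries.X 0), Ideal.Quotient.mk _ (MvPowerSeries.X 1)}).map (Scheme.ΓSpecIso (.of M)).inv.hom)) := by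
    have h1 := hπ.pullback_snd_of_flat ι
    rwa [show ι = Spec.map c ≫ X.fromSpecStalk (π.base x') from rfl,
      comap_SpecMap_comp_fromSpecStalk_eq_ofIdealTop, hcentre'] at h1
  -- the point `y` of `X' ×_X Spec M` over `x'` and the closed point of `Spec M`
  have hι0 : ι.base (closedPoint M) = π.base x' := by
    change (X.fromSpecStalk (π.base x')).base ((Spec.map c).base (closedPoint M)) = π.base x'
    rw [Spec_closedPoint, Scheme.fromSpecStalk_closedPoint]
  obtain ⟨y, hy₁, hy₂⟩ := Scheme.Pullback.exists_preimage_pullback (f := π) (g := ι) x'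
    (closedPoint M) hι0.symm
  -- `y` is singular: `𝒪_{X',x'} → 𝒪_{P,y}` is flat and local
  have hy's : ¬ IsRegularLocalRing ((pullback π ι).presheaf.stalk y) := by
    intro hreg
    apply hx's
    rw [← hy₁]
    exact IsRegularLocalRing.of_flat_ringHom ((pullback.fst π ι).stalkMap y).hom
      (Flat.stalkMap (pullback.fst π ι) y)
  -- `y` lies over the centre
  have hyc : ((Ideal.span {t a₀, t b₀}).map (DeJong1996.NodeDeformationRing.ofBase A _) ⊔
              Ideal.span {Ideal.Quotient.mk _ (MvPowerSeries.X 0), Ideal.Quotient.mk _ (MvPowerSeries.X 1)}) ≤ ((pullback.snd π ι).base y).asIdeal := by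
    rw [hy₂, ← hcentre', Ideal.map_le_iff_le_comap]
    change _ ≤ (PrimeSpectrum.comap c.hom (closedPoint M)).asIdeal
    rw [IsLocalRing.comap_closedPoint]
    refine (mem_support_iff_stalkIdeal_le _ _).mp ?_
    rw [← SetLike.mem_coe, Scheme.IdealSheafData.coe_support_vanishingIdeal]
    exact hx
  -- the chart computation: `y` lies on the strict transform of some `V(𝔭_{ab})`
  obtain ⟨a, b, hab, hbs, hycl⟩ :=
    hNB A (d - 1) t hspan hdim s a₀ b₀ hab₀ hb₀s _ (pullback.snd π ι) hB y hyc hy's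
  -- the component `E''` of `Sing X` through `x` with `Î_{E''} = 𝔭_{ab}`
  obtain ⟨E'', hE'', -, hE''eq⟩ := hdict2 a b hab hbs
  have hE''c : IsClosed E'' := componentsIn.isClosed hS hE''
  have hE''eq' : (stalkIdeal (vanishingIdeal ⟨E'', hE''c⟩) (π.base x')).map c.hom = ((Ideal.span {t a, t b}).map (DeJong1996.NodeDeformationRing.ofBase A _) ⊔
              Ideal.span {Ideal.Quotient.mk _ (MvPowerSeries.X 0), Ideal.Quotient.mk _ (MvPowerSeries.X 1)}) := by
    have hC : (⟨closure E'', isClosed_closure⟩ : Closeds X) = ⟨E'', hE''c⟩ :=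
      Closeds.ext hE''c.closure_eq
    rw [← hC, hmapc _ ⟨U, hU⟩ hxU, hE''eq ⟨U, hU⟩ hxU]
  -- `x' = fst y` lies on `Ẽ''`: project the strict transform of `V(𝔭_{ab})` down to `X'`
  have hmem : x' ∈ strictTransformSet π (closure (⋃ g : G, (ρ g).hom.base '' (Subtype.val '' E))) E'' := by
    rw [← hy₁]
    have h1 := image_closure_subset_closure_image (f := (pullback.fst π ι).base)
      (s := (pullback.snd π ι).base ⁻¹' {w | ((Ideal.span {t a, t b}).map (DeJong1996.NodeDeformationRing.ofBase A _) ⊔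
              Ideal.span {Ideal.Quotient.mk _ (MvPowerSeries.X 0), Ideal.Quotient.mk _ (MvPowerSeries.X 1)}) ≤ w.asIdeal ∧ ¬ ((Ideal.span {t a₀, t b₀}).map (DeJong1996.NodeDeformationRing.ofBase A _) ⊔
              Ideal.span {Ideal.Quotient.mk _ (MvPowerSeries.X 0), Ideal.Quotient.mk _ (MvPowerSeries.X 1)}) ≤ w.asIdeal})
      (pullback.fst π ι).continuous
    refine closure_mono ?_ (h1 ⟨y, hycl, rfl⟩)
    rintro _ ⟨w, ⟨hw₁, hw₂⟩, rfl⟩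
    rw [Set.mem_preimage, ← Scheme.Hom.comp_apply, pullback.condition]
    constructor
    · exact (SpecMap_comp_fromSpecStalk_mem_iff (π.base x') c ⟨E'', hE''c⟩ _).mpr (hE''eq' ▸ hw₁)
    · intro hmemC
      exact hw₂ (hcentre' ▸ (SpecMap_comp_fromSpecStalk_mem_iff (π.base x') c
        ⟨closure (⋃ g : G, (ρ g).hom.base '' (Subtype.val '' E)), isClosed_closure⟩ _).mp hmemC)
  refine ⟨E'', hE'', fun hsub => ?_, hmem⟩
  rw [strictTransformSet_eq_empty_of_subset π hsub] at hmem
  exact hmem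

/-- **(O1) from the chart computation on the coefficient-free model** — the hypothesis `hO1` of
`quasiSplitNormalFormPair_blowup_of_overCentre` with the binders of the stub, from the single
model-level statement `hNB`. [cite: DeJong1996, 4.27, pp. 75–76] [cite: DeJong1997, proof of Prop. 5.11, p. 619] -/
theorem stub_pair_orbitNormalFormBlowup_singularOverCentre_of_model (k : Type) [Field k]
    [PerfectField k] (G : Type) [Group G] [Finite G] (X : Scheme.{0}) (p : X ⟶ Spec (.of k))
    (ρ : G →* Aut X) (Z : Set X) (d : ℕ) (hP : DeJong1997.QuasiSplitNormalFormPair p Z ρ d)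
    (E : Set ↥({x : X | ¬ IsRegularLocalRing (X.presheaf.stalk x)} : Set X))
    (hE : E ∈ irreducibleComponents ↥({x : X | ¬ IsRegularLocalRing (X.presheaf.stalk x)} : Set X))
    (X' : Scheme.{0}) (π : X' ⟶ X)
    (hπ : IsBlowup π (Scheme.IdealSheafData.vanishingIdeal
      ⟨closure (⋃ g : G, (ρ g).hom.base '' (Subtype.val '' E)), isClosed_closure⟩))
    (hNB : ∀ (A : Type) [CommRing A] [IsRegularLocalRing A] (m : ℕ) (t : Fin m → A),
      Ideal.span (Set.range t) = maximalIdeal A → ringKrullDim A = m →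
      ∀ (s : ℕ) (a₀ b₀ : Fin m), a₀ < b₀ → b₀.val < s →
      ∀ (B : Scheme.{0}) (ρ₁ : B ⟶ Spec (.of (DeJong1996.NodeDeformationRing A
          (∏ i ∈ Finset.univ.filter (fun i : Fin m => i.val < s), t i)))),
        IsBlowup ρ₁ (ofIdealTop
          (((Ideal.span {t a₀, t b₀}).map (DeJong1996.NodeDeformationRing.ofBase A _) ⊔
              Ideal.span {Ideal.Quotient.mk _ (MvPowerSeries.X 0), Ideal.Quotient.mk _ (MvPowerSeries.X 1)}).map (Scheme.ΓSpecIso (.of (DeJong1996.NodeDeformationRing A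
            (∏ i ∈ Finset.univ.filter (fun i : Fin m => i.val < s), t i)))).inv.hom)) →
        ∀ y : B, ((Ideal.span {t a₀, t b₀}).map (DeJong1996.NodeDeformationRing.ofBase A _) ⊔
              Ideal.span {Ideal.Quotient.mk _ (MvPowerSeries.X 0), Ideal.Quotient.mk _ (MvPowerSeries.X 1)}) ≤ (ρ₁.base y).asIdeal → ¬ IsRegularLocalRing (B.presheaf.stalk y) →
          ∃ a b : Fin m, a < b ∧ b.val < s ∧
            y ∈ closure (ρ₁.base ⁻¹' {w | ((Ideal.span {t a, t b}).map (DeJong1996.NodeDeformationRing.ofBase A _) ⊔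
              Ideal.span {Ideal.Quotient.mk _ (MvPowerSeries.X 0), Ideal.Quotient.mk _ (MvPowerSeries.X 1)}) ≤ w.asIdeal ∧ ¬ ((Ideal.span {t a₀, t b₀}).map (DeJong1996.NodeDeformationRing.ofBase A _) ⊔
              Ideal.span {Ideal.Quotient.mk _ (MvPowerSeries.X 0), Ideal.Quotient.mk _ (MvPowerSeries.X 1)}) ≤ w.asIdeal})) :
    ∀ x' : X', π.base x' ∈ closure (⋃ g : G, (ρ g).hom.base '' (Subtype.val '' E)) →
      (¬ IsRegularLocalRing (X'.presheaf.stalk x') ↔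
        ∃ E' ∈ componentsIn ({x : X | ¬ IsRegularLocalRing (X.presheaf.stalk x)} : Set X),
          ¬ E' ⊆ closure (⋃ g : G, (ρ g).hom.base '' (Subtype.val '' E)) ∧
            x' ∈ strictTransformSet π (closure (⋃ g : G, (ρ g).hom.base '' (Subtype.val '' E))) E') :=
  fun x' hx => singularOverCentre_of_closedPoints hP isClosed_closure hπ
    (fun _ hx'c hx₁ hx's => singularOverCentre_closedPoint_of_model hP hE hπ hNB hx'c hx₁ hx's) x' hx

end Summit.ResolutionOfSingularities.ResolutionOfSingularities.Theorems

end
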